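import Summits.BirchSwinnertonDyer.Rank1Residual.Additive.TwistPartnerForcedReduction
import Summits.BirchSwinnertonDyer.Rank1Residual.Additive.TameBranchOfSemistableTwistJoin
import HarnessLib

/-!
# The forced twist partner on defect 2, ODD branch (`p ≡ 3 (mod 4)`): it is the `p`-stabilised
# MINUS symbol of the twist curve — the boundedness criterion is met with THE unit root
# (cell `b2b-bsdres`, sub-cell additive-p2 = X3♯(G-ord) / X4♯(G-ord), gen 23; odd twin of
# `TwistPartnerForcedDefectTwo.lean` over cc-typer-2's `TameBranchOfSemistableTwistJoin.lean` §6)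

HONEST FRAMING (cell `b2b-bsdres`, run/shared/lean/b2b/bsd-rank1-residual/, verbatim in every
file): the goal of the cell is to DELETE the COMBINATION-SHAPED residual classes of the
Birch–Swinnerton-Dyer formula for ALL analytic-rank `≤ 1` elliptic curves over `ℚ` — "full BSD
formula for every rank `≤ 1` curve in class `C`" assembled STRICTLY from published theorems — so
that the rank-`≤ 1` remainder becomes exactly the CONSTRUCTION-SHAPED classes, which are TYPED
(missing-input `Prop`s), NOT attempted. This is not "finishing BSD". Sub-cell additive-p2: the
classes X3♯(G-ord) / X4♯(G-ord) are CONSTRUCTION-SHAPED and stay so; labels / RESIDUAL-MAP marks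
UNCHANGED; nothing is booked. THEOREMS ONLY (no definition, no named fact, no conjecture node).

## What

`TwistPartnerForcedDefectTwo.lean` identified, on the EVEN branch (`LegendreTwistPlusRel`: `p* = p`,
`p ≡ 1 (mod 4)`), the forced partner `TwistPartner.forced χ_p [·]⁺_f ã` with cc-typer-2's
`p`-stabilised PLUS symbol of the twist curve. Here the ODD branch (`LegendreTwistMinusRel`:
`p* = −p`, `p ≡ 3 (mod 4)`, the twist swaps real and imaginary periods, so the partner symbol is the
MINUS symbol `c·[·]⁻_g` of `g = f_{E♭}`):

* §1 `forced_legendreMinus_eq_stabilisedSymbol_of_goodOrd` — (G-ord, `e = 2`): for `V = E♭` good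
  ordinary at `p` with newform `g` and `LegendreTwistMinusRel p f g c`,
  `forced χ_p [·]⁺_f (unitRoot V p) = stabilisedSymbol (c·[·]⁻_g) (unitRoot V p) 1` (minus Hecke
  relation `intCast_mul_ratMinusSymbol`, rationality `ratCast_ratMinusSymbol`); hence
  `exists_bound_forced_legendreMinus_of_goodOrd` — bounded with THE unit root, GIVEN a common
  denominator of the minus symbols (`hden`, the explicit Manin–Drinfeld binder of
  `TameBranchOfSemistableTwistJoin.lean` §6);
* §2 `forced_legendreMinus_eq_of_mult`, `exists_bound_forced_legendreMinus_of_mult` — the (M) twins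
  (`p ∣ N'`, `a_p(g) = ±1`, `U_p` relation `intCast_mul_ratMinusSymbol_of_dvd`; no stabilisation).

So on every defect-2 row of either parity the forced partner of gen 23 IS the dictionary object of
gen 22 (`isTameBranchOf_legendre_C_mul_padicLFunction[Minus]Branch[Mult]`), up to the bridge.

References: B. Mazur, J. Tate, J. Teitelbaum, Invent. Math. 84 (1986) §I.4 (4.2), §I.8, §I.10
(10.1)–(10.2) [MazurTateTeitelbaum1986Invent]; D. Delbourgo, Compositio Math. 113 (1998) §1.5,
hypothesis (M) p. 133 [Delbourgo1998]; G. Shimura (1971) Prop. 3.64 [Shimura1971].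
-/

noncomputable section

open scoped Classical MatrixGroups ModularForm

open CongruenceSubgroup

namespace Summit.BirchSwinnertonDyer.Rank1Residual.Additive

open Literature.NumberTheory.EllipticCurves Literature.NumberTheory.EllipticCurves.ModularForms
  Literature.NumberTheory.EllipticCurves.Rank1Residual

/-! ### §1 (G-ord, `e = 2`), odd branch: the forced partner is the `p`-stabilised MINUS symbol -/

section GoodOrdinary

variable {p : ℕ} [hp : Fact p.Prime] {N N' : ℕ} [NeZero N] [NeZero N'] {f : CuspForm (Gamma0 N) 2}
  {g : CuspForm (Gamma0 N') 2} (V : WeierstrassCurve ℚ) [V.IsElliptic] [V.IsGloballyMinimal]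

/-- **(G-ord, `e = 2`), odd branch: the forced partner IS the `p`-stabilised minus symbol of the
twist curve**: `forced χ_p [·]⁺_f (unitRoot V p) = stabilisedSymbol (c·[·]⁻_g) (unitRoot V p) 1`
under `LegendreTwistMinusRel p f g c` (`V = E♭` good ordinary at the odd `p`, newform `g`).
[cite: MazurTateTeitelbaum1986Invent, §I.4 (4.2) and §I.10 (10.1)–(10.2)] -/
theorem forced_legendreMinus_eq_stabilisedSymbol_of_goodOrd (hp2 : p ≠ 2) (hord : IsOrdinaryAt V p)
    (hg : IsNewformOf V g) {c : ℚ} (hrel : LegendreTwistMinusRel p f g c) :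
    TwistPartner.forced (legendreChar p) (fun r ↦ ((ratPlusSymbol f r : ℚ) : ℚ_[p]))
        (unitRoot V p : ℚ_[p]) =
      stabilisedSymbol (fun r ↦ (c : ℚ_[p]) * ((ratMinusSymbol g r : ℚ) : ℚ_[p]))
        (unitRoot V p : ℚ_[p]) 1 := by
  haveI : NeZero p := ⟨hp.out.ne_zero⟩
  have hrat := ratCast_ratMinusSymbol g hg.1 (IsNewformOf.coeffField_eq_bot hg)
  obtain ⟨hαeq, hαu, -⟩ := unitRoot_coe_spec (W := V) hord
  have hα0 : (unitRoot V p : ℚ_[p]) ≠ 0 := fun h ↦ by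
    rw [h, norm_zero] at hαu; exact zero_ne_one hαu
  have hpN : ¬ p ∣ N' := not_dvd_level_of_isNewformOf hg hord.1
  have hap := cuspCoeff_eq_frobeniusTrace_of_isNewformOf_holds hg hord.1
  have hχ : legendreChar p ≠ 1 := legendreChar_ne_one p hp2
  have hχi : (legendreChar p)⁻¹ ≠ 1 := fun h1 ↦ hχ (inv_eq_one.mp h1)
  set S : ℚ → ℚ_[p] := fun r ↦ (c : ℚ_[p]) * ((ratMinusSymbol g r : ℚ) : ℚ_[p]) with hSdef
  have hperS : ∀ s, S (s + 1) = S s := fun s ↦ by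
    simp only [hSdef]
    rw [show (s + 1 : ℚ) = s + ((1 : ℤ) : ℚ) by push_cast; rfl, ratMinusSymbol_add_intCast]
  have hperx : ∀ s, (fun r ↦ ((ratPlusSymbol f r : ℚ) : ℚ_[p])) (s + 1) =
      (fun r ↦ ((ratPlusSymbol f r : ℚ) : ℚ_[p])) s := fun s ↦ by
    simp only
    rw [show (s + 1 : ℚ) = s + ((1 : ℤ) : ℚ) by push_cast; rfl, ratPlusSymbol_add_intCast_eq]
  have hH : ∀ r : ℚ, ((V.frobeniusTrace p : ℤ) : ℚ_[p]) * S r =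
      ∑ j : Fin p, S ((r + ((j : ℕ) : ℚ)) / p) + 1 * S (p * r) := by
    intro r
    have h := intCast_mul_ratMinusSymbol p hg.1 hp.out hpN hap hrat r
    have h' := congrArg (fun q : ℚ ↦ (c : ℚ_[p]) * (q : ℚ_[p])) h
    push_cast at h'
    rw [mul_add, Finset.mul_sum] at h'
    simp only [hSdef]
    linear_combination h'
  have hαpoly : (unitRoot V p : ℚ_[p]) ^ 2 - ((V.frobeniusTrace p : ℤ) : ℚ_[p]) * (unitRoot V p : ℚ_[p])
      + 1 * p = 0 := by
    rw [one_mul]; exact hαeq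
  have hper := stabilisedSymbol_add_one (α := (unitRoot V p : ℚ_[p])) (δ := (1 : ℚ_[p])) hperS
  have hx : ∀ s, (fun r ↦ ((ratPlusSymbol f r : ℚ) : ℚ_[p])) s =
      CensusX43.twist (legendreChar p)⁻¹
        (stabilisedSymbol S (unitRoot V p : ℚ_[p]) 1) s := fun s ↦ by
    simp only
    rw [hrel.cast_eq_twist, twist_stabilisedSymbol hperS hχi]
  have hU := sum_stabilisedSymbol_eq hperS hH hαpoly hα0
  exact (TwistPartner.eq_forced_of_partner hχ hαu hperx hper hx hU).symm

/-- **Hence, odd branch, (G-ord, `e = 2`): the forced partner for THE unit root is bounded**, given a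
common denominator `D` of the minus symbols of `g` (`hden`, Manin–Drinfeld for `[·]⁻_g`; explicit
binder as in `exists_isTameBranchOf_legendreMinus_of_goodOrd`). [cite: MazurTateTeitelbaum1986Invent, §I.10 (10.1)] -/
theorem exists_bound_forced_legendreMinus_of_goodOrd (hp2 : p ≠ 2) (hord : IsOrdinaryAt V p)
    (hg : IsNewformOf V g) {D : ℕ} (hD : 0 < D)
    (hden : ∀ r : ℚ, ∃ m : ℤ, ratMinusSymbol g r = (m : ℚ) / D)
    {c : ℚ} (hrel : LegendreTwistMinusRel p f g c) :
    ∃ C : ℝ, ∀ s, ‖TwistPartner.forced (legendreChar p) (fun r ↦ ((ratPlusSymbol f r : ℚ) : ℚ_[p]))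
      (unitRoot V p : ℚ_[p]) s‖ ≤ C := by
  haveI : NeZero p := ⟨hp.out.ne_zero⟩
  obtain ⟨c', hlat⟩ := exists_forall_eq_mul_padicInt_of_eq_div (p := p) hD hden c
  obtain ⟨-, hαu, -⟩ := unitRoot_coe_spec (W := V) hord
  rw [forced_legendreMinus_eq_stabilisedSymbol_of_goodOrd V hp2 hord hg hrel]
  refine ⟨‖c'‖, fun s ↦ ?_⟩
  obtain ⟨z, hz⟩ := exists_stabilisedSymbol_eq_mul (δ := (1 : ℚ_[p])) hαu (by rw [norm_one]) hlat s
  rw [hz, norm_mul]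
  exact mul_le_of_le_one_right (norm_nonneg _) z.norm_le_one

end GoodOrdinary

/-! ### §2 (M), odd branch: the forced partner is `c·[·]⁻_{f♭}` itself -/

section Multiplicative

variable {p : ℕ} [hp : Fact p.Prime] {N N' : ℕ} [NeZero N] [NeZero N'] {f : CuspForm (Gamma0 N) 2}
  {g : CuspForm (Gamma0 N') 2}

/-- **(M), odd branch: the forced partner IS `c·[·]⁻_g`** (`p ∣ N'`, `a_p(g) = ±1`,
`LegendreTwistMinusRel p f g c`): `forced χ_p [·]⁺_f (a_p(g)) = c·[·]⁻_g`.
[cite: MazurTateTeitelbaum1986Invent, §I.10 (10.1) with ε(p) = 0] [cite: Delbourgo1998, hypothesis (M) (p. 133)] -/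
theorem forced_legendreMinus_eq_of_mult (hp2 : p ≠ 2) (hg : IsNewform0 g) (hQ : coeffField g = ⊥)
    (hpN : p ∣ N') {ap : ℤ} (hap : cuspCoeff g p = ap) (hap1 : ap = 1 ∨ ap = -1) {c : ℚ}
    (hrel : LegendreTwistMinusRel p f g c) :
    TwistPartner.forced (legendreChar p) (fun r ↦ ((ratPlusSymbol f r : ℚ) : ℚ_[p]))
        ((ap : ℤ) : ℚ_[p]) =
      fun r ↦ (c : ℚ_[p]) * ((ratMinusSymbol g r : ℚ) : ℚ_[p]) := by
  haveI : NeZero p := ⟨hp.out.ne_zero⟩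
  have hrat := ratCast_ratMinusSymbol g hg hQ
  have hαu : ‖((ap : ℤ) : ℚ_[p])‖ = 1 := by
    rcases hap1 with h | h <;> simp [h]
  have hα0 : ((ap : ℤ) : ℚ_[p]) ≠ 0 := fun h ↦ by rw [h, norm_zero] at hαu; exact zero_ne_one hαu
  have hχ : legendreChar p ≠ 1 := legendreChar_ne_one p hp2
  have hχi : (legendreChar p)⁻¹ ≠ 1 := fun h1 ↦ hχ (inv_eq_one.mp h1)
  set S : ℚ → ℚ_[p] := fun r ↦ (c : ℚ_[p]) * ((ratMinusSymbol g r : ℚ) : ℚ_[p]) with hSdef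
  have hperS : ∀ s, S (s + 1) = S s := fun s ↦ by
    simp only [hSdef]
    rw [show (s + 1 : ℚ) = s + ((1 : ℤ) : ℚ) by push_cast; rfl, ratMinusSymbol_add_intCast]
  have hperx : ∀ s, (fun r ↦ ((ratPlusSymbol f r : ℚ) : ℚ_[p])) (s + 1) =
      (fun r ↦ ((ratPlusSymbol f r : ℚ) : ℚ_[p])) s := fun s ↦ by
    simp only
    rw [show (s + 1 : ℚ) = s + ((1 : ℤ) : ℚ) by push_cast; rfl, ratPlusSymbol_add_intCast_eq]
  have hH : ∀ r : ℚ, ((ap : ℤ) : ℚ_[p]) * S r =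
      ∑ j : Fin p, S ((r + ((j : ℕ) : ℚ)) / p) + 0 * S (p * r) := by
    intro r
    have h := intCast_mul_ratMinusSymbol_of_dvd p hg hp.out hpN hap hrat r
    have h' := congrArg (fun q : ℚ ↦ (c : ℚ_[p]) * (q : ℚ_[p])) h
    push_cast at h'
    rw [Finset.mul_sum] at h'
    simp only [hSdef]
    linear_combination h'
  have hαpoly : ((ap : ℤ) : ℚ_[p]) ^ 2 - ((ap : ℤ) : ℚ_[p]) * ((ap : ℤ) : ℚ_[p]) + 0 * p = 0 := by
    ring
  have hper := stabilisedSymbol_add_one (α := ((ap : ℤ) : ℚ_[p])) (δ := (0 : ℚ_[p])) hperS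
  have hx : ∀ s, (fun r ↦ ((ratPlusSymbol f r : ℚ) : ℚ_[p])) s =
      CensusX43.twist (legendreChar p)⁻¹ (stabilisedSymbol S ((ap : ℤ) : ℚ_[p]) 0) s := fun s ↦ by
    simp only
    rw [hrel.cast_eq_twist, twist_stabilisedSymbol hperS hχi]
  have hU := sum_stabilisedSymbol_eq hperS hH hαpoly hα0
  have h := (TwistPartner.eq_forced_of_partner hχ hαu hperx hper hx hU).symm
  rw [h]
  funext r
  rw [stabilisedSymbol_apply, mul_zero, zero_mul, sub_zero]

/-- **Hence, odd branch, (M): the forced partner for `α = a_p(E♭)` is bounded**, given a common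
denominator of the minus symbols of `g` (`hden`). [cite: MazurTateTeitelbaum1986Invent, §I.10 (10.1)] -/
theorem exists_bound_forced_legendreMinus_of_mult (hp2 : p ≠ 2) (hg : IsNewform0 g)
    (hQ : coeffField g = ⊥) (hpN : p ∣ N') {ap : ℤ} (hap : cuspCoeff g p = ap)
    (hap1 : ap = 1 ∨ ap = -1) {D : ℕ} (hD : 0 < D)
    (hden : ∀ r : ℚ, ∃ m : ℤ, ratMinusSymbol g r = (m : ℚ) / D)
    {c : ℚ} (hrel : LegendreTwistMinusRel p f g c) :
    ∃ C : ℝ, ∀ s, ‖TwistPartner.forced (legendreChar p) (fun r ↦ ((ratPlusSymbol f r : ℚ) : ℚ_[p]))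
      ((ap : ℤ) : ℚ_[p]) s‖ ≤ C := by
  haveI : NeZero p := ⟨hp.out.ne_zero⟩
  obtain ⟨c', hlat⟩ := exists_forall_eq_mul_padicInt_of_eq_div (p := p) hD hden c
  rw [forced_legendreMinus_eq_of_mult hp2 hg hQ hpN hap hap1 hrel]
  refine ⟨‖c'‖, fun s ↦ ?_⟩
  obtain ⟨z, hz⟩ := hlat s
  simp only
  rw [hz, norm_mul]
  exact mul_le_of_le_one_right (norm_nonneg _) z.norm_le_one

end Multiplicative

end Summit.BirchSwinnertonDyer.Rank1Residual.Additive

end
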